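import Summits.ValiantsHypothesis.ValiantsHypothesis.Theorems.LiftNullstellensatzLiftWidthPerFourCaseB
import Literature.RingTheory.MvPolynomial.LinearFormsCoeff
import Literature.RingTheory.MvPolynomial.VanishingOnSubspace

/-!
# Route LiftNullstellensatz — `LiftWidthPerFour` (stmt-ValiantsHypothesis-5922), CASE A rung 1:
syzygies of three `2 × 2` permanents

Normalised coordinates for CASE A with `ℓ = ℓ' = 0` (format `(4,5,4)`): outer rows `0` and `3`,
middle rows `1` ("`y`") and `2` ("`z`"), killed column `0`.  The three quadrics
`p23 = y₂z₃ + y₃z₂`, `p13 = y₁z₃ + y₃z₁`, `p12 = y₁z₂ + y₂z₁` (`2 × 2` permanents of the middle rows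
on the live columns `1,2,3`) are the first row/column of `G|_{y₀ = z₀ = 0}`.  This file proves the
two syzygy facts used in the rank-`2` step of the rung-1 argument
(`Cruxes/LiftWidthPerFour/CASEA-RUNG1-p2.md` §3):

* `linSyzygy_eq_zero` — a syzygy `L₁ p23 + L₂ p13 + L₃ p12 = 0` with LINEAR coefficients is zero
  (the quadratic case, `quadSyzygy_koszul`, is in the companion file `…RungOneKoszul`).

Method: "peeling" — substitutions killing pairs of variables (`aeval`), cancellation in the domain
`K[x]`, membership in variable ideals (`sub_aeval_ite_mem_ideal_span`), homogeneous components, and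
finally evaluation at `0/1` points.  Toolkit lemmas: `homogeneousComponent_X_mul`,
`eq_sum_of_kill_eq_zero` (a linear form killed by `x_T ↦ 0` is supported on `T`),
`exists_linear_of_kill_pair_eq_zero` (a quadric killed by `x_v, x_w ↦ 0` is `x_v u + x_w u'` with
`u, u'` linear).  No new definitions.  VP ≠ VNP is not moved by this item.
-/

noncomputable section

open MvPolynomial

namespace Summit.ValiantsHypothesis.LiftNullstellensatz

variable {K : Type*} [Field K] {σ : Type*}

/-! ### Toolkit -/

/-- `homogeneousComponent (n+1) (X v * g) = X v * homogeneousComponent n g`. [folklore] -/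
theorem homogeneousComponent_X_mul [DecidableEq σ] (v : σ) (g : MvPolynomial σ K) (n : ℕ) :
    homogeneousComponent (n + 1) (X v * g) = X v * homogeneousComponent n g := by
  classical
  ext d
  rw [coeff_homogeneousComponent, coeff_X_mul', coeff_X_mul', coeff_homogeneousComponent]
  by_cases hvd : v ∈ d.support
  · rw [if_pos hvd, if_pos hvd]
    have hle : Finsupp.single v 1 ≤ d :=
      Finsupp.single_le_iff.2 (Nat.one_le_iff_ne_zero.2 (Finsupp.mem_support_iff.1 hvd))
    have hdeg : d.degree = (d - Finsupp.single v 1).degree + 1 := by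
      conv_lhs => rw [← tsub_add_cancel_of_le hle]
      rw [map_add, Finsupp.degree_single]
    by_cases h1 : (d - Finsupp.single v 1).degree = n
    · rw [if_pos h1, if_pos (by rw [hdeg, h1])]
    · rw [if_neg h1, if_neg (by rw [hdeg]; omega)]
  · rw [if_neg hvd, if_neg hvd, ite_self]

/-- A linear form killed by `x_v ↦ 0 (v ∈ T)` is a combination of the `x_v`, `v ∈ T`, namely
`f = Σ_{v ∈ T} coeff_{x_v}(f) • x_v`. [folklore] -/
theorem eq_sum_of_kill_eq_zero [Fintype σ] [DecidableEq σ] (T : Finset σ)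
    {f : MvPolynomial σ K} (hf : f.IsHomogeneous 1)
    (hkill : aeval (fun v => if v ∈ T then (0 : MvPolynomial σ K) else X v) f = 0) :
    f = ∑ v ∈ T, coeff (Finsupp.single v 1) f • (X v : MvPolynomial σ K) := by
  classical
  have hf' := Literature.RingTheory.MvPolynomial.eq_sum_coeff_single_one_smul_X hf
  -- the killed form is the sum over `v ∉ T`
  have hk : aeval (fun v => if v ∈ T then (0 : MvPolynomial σ K) else X v) f =
      ∑ v, (if v ∈ T then 0 else coeff (Finsupp.single v 1) f) • (X v : MvPolynomial σ K) := by
    conv_lhs => rw [hf']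
    rw [map_sum]
    refine Finset.sum_congr rfl fun v _ => ?_
    rw [map_smul, aeval_X]
    split_ifs <;> simp
  rw [hk, Literature.RingTheory.MvPolynomial.sum_smul_X_eq_zero_iff] at hkill
  conv_lhs => rw [hf']
  rw [← Finset.sum_filter_add_sum_filter_not Finset.univ (· ∈ T)]
  have h1 : ∑ v ∈ Finset.univ.filter (· ∈ T), coeff (Finsupp.single v 1) f • (X v : MvPolynomial σ K)
      = ∑ v ∈ T, coeff (Finsupp.single v 1) f • (X v : MvPolynomial σ K) := by
    refine Finset.sum_congr ?_ fun _ _ => rfl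
    ext v; simp
  have h2 : ∑ v ∈ Finset.univ.filter (fun v => ¬ v ∈ T),
      coeff (Finsupp.single v 1) f • (X v : MvPolynomial σ K) = 0 := by
    refine Finset.sum_eq_zero fun v hv => ?_
    rw [Finset.mem_filter] at hv
    have := congr_fun hkill v
    simp only [if_neg hv.2, Pi.zero_apply] at this
    rw [this, zero_smul]
  rw [h1, h2, add_zero]

/-- A linear form killed by `x_v, x_w ↦ 0` (`v ≠ w`) is `c • x_v + c' • x_w`. [folklore] -/
theorem exists_pair_of_kill_eq_zero [Fintype σ] [DecidableEq σ] {v w : σ} (hvw : v ≠ w)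
    {f : MvPolynomial σ K} (hf : f.IsHomogeneous 1)
    (hkill : aeval (fun i => if i ∈ ({v, w} : Finset σ) then (0 : MvPolynomial σ K) else X i) f = 0) :
    ∃ c c' : K, f = C c * X v + C c' * X w := by
  have h := eq_sum_of_kill_eq_zero {v, w} hf hkill
  rw [Finset.sum_pair hvw, smul_eq_C_mul, smul_eq_C_mul] at h
  exact ⟨_, _, h⟩

/-- A linear form killed by `x_v ↦ 0` is `c • x_v`. [folklore] -/
theorem exists_single_of_kill_eq_zero [Fintype σ] [DecidableEq σ] (v : σ)
    {f : MvPolynomial σ K} (hf : f.IsHomogeneous 1)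
    (hkill : aeval (fun i => if i ∈ ({v} : Finset σ) then (0 : MvPolynomial σ K) else X i) f = 0) :
    ∃ c : K, f = C c * X v := by
  have h := eq_sum_of_kill_eq_zero {v} hf hkill
  rw [Finset.sum_singleton, smul_eq_C_mul] at h
  exact ⟨_, h⟩

/-- A homogeneous quadric killed by `x_v, x_w ↦ 0` is `x_v u + x_w u'` with `u, u'` homogeneous
linear forms. [folklore] -/
theorem exists_linear_of_kill_pair_eq_zero [DecidableEq σ] (v w : σ)
    {n : MvPolynomial σ K} (hn : n.IsHomogeneous 2)
    (hkill : aeval (fun i => if i ∈ ({v, w} : Set σ) then (0 : MvPolynomial σ K) else X i) n = 0) :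
    ∃ u u' : MvPolynomial σ K, u.IsHomogeneous 1 ∧ u'.IsHomogeneous 1 ∧ n = X v * u + X w * u' := by
  classical
  have hmem : n ∈ Ideal.span (X '' ({v, w} : Set σ) : Set (MvPolynomial σ K)) := by
    have h := Literature.RingTheory.MvPolynomial.sub_aeval_ite_mem_ideal_span ({v, w} : Set σ) n
    rwa [hkill, sub_zero] at h
  rw [Set.image_pair, Ideal.mem_span_pair] at hmem
  obtain ⟨g, g', hgg'⟩ := hmem
  refine ⟨homogeneousComponent 1 g, homogeneousComponent 1 g',
    homogeneousComponent_isHomogeneous 1 g, homogeneousComponent_isHomogeneous 1 g', ?_⟩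
  have h2 : homogeneousComponent 2 n = n := homogeneousComponent_eq_self hn
  rw [← h2, ← hgg', map_add, mul_comm g, mul_comm g', homogeneousComponent_X_mul,
    homogeneousComponent_X_mul]

/-! ### The three quadrics and their syzygies (normalised indices: rows `1,2`, columns `1,2,3`) -/

section Concrete

/-- `p23 = y₂z₃ + y₃z₂ ≠ 0` (and its two siblings), by evaluation at a `0/1` point. [folklore] -/
theorem perm22_ne_zero (b d : Fin 4) (hbd : b ≠ d) :
    (X (1, b) * X (2, d) + X (1, d) * X (2, b) : MvPolynomial (Fin 4 × Fin 4) K) ≠ 0 := by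
  intro h
  have := congrArg (eval fun w => if w ∈ ({((1 : Fin 4), b), (2, d)} : Finset (Fin 4 × Fin 4))
    then (1 : K) else 0) h
  simp only [map_add, map_mul, eval_X, map_zero, Finset.mem_insert, Finset.mem_singleton,
    Prod.mk.injEq] at this
  simp [hbd, hbd.symm] at this

/-- **No linear syzygies**: if `L₁ p23 + L₂ p13 + L₃ p12 = 0` with linear forms `Lᵢ`
(`2 ≠ 0` in `K`), then `L₁ = L₂ = L₃ = 0`.  (In characteristic `2`,
`(y₁+z₁, y₂+z₂, y₃+z₃)` is a syzygy.) [folklore] -/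
theorem linSyzygy_eq_zero (h2 : (2 : K) ≠ 0) (L₁ L₂ L₃ : MvPolynomial (Fin 4 × Fin 4) K)
    (hL₁ : L₁.IsHomogeneous 1) (hL₂ : L₂.IsHomogeneous 1) (hL₃ : L₃.IsHomogeneous 1)
    (h : L₁ * (X (1, 2) * X (2, 3) + X (1, 3) * X (2, 2)) +
         L₂ * (X (1, 1) * X (2, 3) + X (1, 3) * X (2, 1)) +
         L₃ * (X (1, 1) * X (2, 2) + X (1, 2) * X (2, 1)) = 0) :
    L₁ = 0 ∧ L₂ = 0 ∧ L₃ = 0 := by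
  classical
  -- Step 1: each `Lₖ` is supported on the two variables of column `k`
  have key : ∀ (k : Fin 4) (L M N : MvPolynomial (Fin 4 × Fin 4) K) (b d : Fin 4),
      L.IsHomogeneous 1 → k ≠ b → k ≠ d → b ≠ d →
      L * (X (1, b) * X (2, d) + X (1, d) * X (2, b)) +
        M * (X (1, k) * X (2, d) + X (1, d) * X (2, k)) +
        N * (X (1, k) * X (2, b) + X (1, b) * X (2, k)) = 0 →
      L = coeff (Finsupp.single (1, k) 1) L • (X (1, k) : MvPolynomial (Fin 4 × Fin 4) K) +
          coeff (Finsupp.single (2, k) 1) L • X (2, k) := by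
    intro k L M N b d hL hkb hkd hbd hLMN
    set T : Finset (Fin 4 × Fin 4) := {(1, k), (2, k)} with hT
    have h12 : ((1 : Fin 4), k) ≠ (2, k) := by simp
    set κ : MvPolynomial (Fin 4 × Fin 4) K →ₐ[K] MvPolynomial (Fin 4 × Fin 4) K :=
      aeval (fun v => if v ∈ T then (0 : MvPolynomial (Fin 4 × Fin 4) K) else X v) with hκ
    have hκX : ∀ v : Fin 4 × Fin 4, κ (X v) = if v ∈ T then 0 else X v := fun v => by
      rw [hκ, aeval_X]
    have hk1 : κ (X (1, b) * X (2, d) + X (1, d) * X (2, b)) =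
        X (1, b) * X (2, d) + X (1, d) * X (2, b) := by
      simp only [map_add, map_mul, hκX, hT, Finset.mem_insert, Finset.mem_singleton, Prod.mk.injEq,
        hkb.symm, hkd.symm, Fin.reduceEq, and_false, or_self, if_false]
    have hk2 : κ (X (1, k) * X (2, d) + X (1, d) * X (2, k)) = 0 := by
      simp only [map_add, map_mul, hκX, hT, Finset.mem_insert, Finset.mem_singleton, Prod.mk.injEq,
        Fin.reduceEq, and_true, true_or, or_true, if_true, zero_mul, mul_zero, add_zero]
    have hk3 : κ (X (1, k) * X (2, b) + X (1, b) * X (2, k)) = 0 := by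
      simp only [map_add, map_mul, hκX, hT, Finset.mem_insert, Finset.mem_singleton, Prod.mk.injEq,
        Fin.reduceEq, and_true, true_or, or_true, if_true, zero_mul, mul_zero, add_zero]
    have hkill : κ L = 0 := by
      have := congrArg κ hLMN
      rw [map_add, map_add, map_mul, map_mul, map_mul, hk1, hk2, hk3, mul_zero, mul_zero, add_zero,
        add_zero, map_zero] at this
      exact (mul_eq_zero.1 this).resolve_right (perm22_ne_zero b d hbd)
    have := eq_sum_of_kill_eq_zero T hL hkill
    rwa [hT, Finset.sum_pair h12] at this
  have e₁ := key 1 L₁ L₂ L₃ 2 3 hL₁ (by decide) (by decide) (by decide) h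
  have e₂ := key 2 L₂ L₁ L₃ 1 3 hL₂ (by decide) (by decide) (by decide)
    (by rw [← h]; ring)
  have e₃ := key 3 L₃ L₁ L₂ 1 2 hL₃ (by decide) (by decide) (by decide)
    (by rw [← h]; ring)
  -- Step 2: the six coefficients vanish (evaluate at six `0/1` points)
  set a := coeff (Finsupp.single ((1 : Fin 4), (1 : Fin 4)) 1) L₁
  set b := coeff (Finsupp.single ((2 : Fin 4), (1 : Fin 4)) 1) L₁
  set c := coeff (Finsupp.single ((1 : Fin 4), (2 : Fin 4)) 1) L₂
  set d := coeff (Finsupp.single ((2 : Fin 4), (2 : Fin 4)) 1) L₂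
  set e := coeff (Finsupp.single ((1 : Fin 4), (3 : Fin 4)) 1) L₃
  set f := coeff (Finsupp.single ((2 : Fin 4), (3 : Fin 4)) 1) L₃
  rw [e₁, e₂, e₃] at h
  have ev : ∀ S : Finset (Fin 4 × Fin 4),
      eval (fun w => if w ∈ S then (1 : K) else 0)
        ((a • (X (1, 1) : MvPolynomial (Fin 4 × Fin 4) K) + b • X (2, 1)) *
            (X (1, 2) * X (2, 3) + X (1, 3) * X (2, 2)) +
          (c • (X (1, 2) : MvPolynomial (Fin 4 × Fin 4) K) + d • X (2, 2)) *
            (X (1, 1) * X (2, 3) + X (1, 3) * X (2, 1)) +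
          (e • (X (1, 3) : MvPolynomial (Fin 4 × Fin 4) K) + f • X (2, 3)) *
            (X (1, 1) * X (2, 2) + X (1, 2) * X (2, 1))) = 0 := by
    intro S; rw [h, map_zero]
  have hne : ∀ i j : Fin 4, ((1 : Fin 4), i) ≠ (2, j) := by decide
  have hne' : ∀ i j : Fin 4, ((2 : Fin 4), i) ≠ (1, j) := by decide
  -- y₁ y₂ z₃ ↦ a + c ; y₁ y₃ z₂ ↦ a + e ; y₂ y₃ z₁ ↦ c + e ; y₂ z₁ z₃ ↦ b + f ; y₃ z₁ z₂ ↦ b + d ;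
  -- y₁ z₂ z₃ ↦ d + f
  have q1 := ev {(1, 1), (1, 2), (2, 3)}
  have q2 := ev {(1, 1), (1, 3), (2, 2)}
  have q3 := ev {(1, 2), (1, 3), (2, 1)}
  have q4 := ev {(1, 2), (2, 1), (2, 3)}
  have q5 := ev {(1, 3), (2, 1), (2, 2)}
  have q6 := ev {(1, 1), (2, 2), (2, 3)}
  simp only [map_add, map_mul, smul_eval, eval_X, Finset.mem_insert, Finset.mem_singleton,
    Prod.mk.injEq, Fin.reduceEq, and_true, and_false, or_false,
    or_true, if_true, if_false, mul_one, mul_zero, add_zero, zero_add] at q1 q2 q3 q4 q5 q6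
  have ha : a = 0 := by
    have : (2 : K) * a = 0 := by linear_combination q1 + q2 - q3
    exact (mul_eq_zero.1 this).resolve_left h2
  have hc : c = 0 := by linear_combination q1 - ha
  have he : e = 0 := by linear_combination q2 - ha
  have hb : b = 0 := by
    have : (2 : K) * b = 0 := by linear_combination q4 + q5 - q6
    exact (mul_eq_zero.1 this).resolve_left h2
  have hf : f = 0 := by linear_combination q4 - hb
  have hd : d = 0 := by linear_combination q5 - hb
  refine ⟨?_, ?_, ?_⟩
  · rw [e₁, ha, hb, zero_smul, zero_smul, add_zero]
  · rw [e₂, hc, hd, zero_smul, zero_smul, add_zero]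
  · rw [e₃, he, hf, zero_smul, zero_smul, add_zero]

/-- Killing the two variables of column `k` in a syzygy `L p_{bd} + M p_{kd} + N p_{kb} = 0` kills
`L` (for any substitution `g` that kills `x_{1k}, x_{2k}` and fixes the four variables of the
columns `b, d`). [folklore] -/
theorem aeval_eq_zero_of_syzygy {k b d : Fin 4} (hbd : b ≠ d)
    (g : Fin 4 × Fin 4 → MvPolynomial (Fin 4 × Fin 4) K)
    (hg1k : g (1, k) = 0) (hg2k : g (2, k) = 0) (hg1b : g (1, b) = X (1, b))
    (hg2b : g (2, b) = X (2, b)) (hg1d : g (1, d) = X (1, d)) (hg2d : g (2, d) = X (2, d))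
    (L M N : MvPolynomial (Fin 4 × Fin 4) K)
    (hLMN : L * (X (1, b) * X (2, d) + X (1, d) * X (2, b)) +
        M * (X (1, k) * X (2, d) + X (1, d) * X (2, k)) +
        N * (X (1, k) * X (2, b) + X (1, b) * X (2, k)) = 0) :
    aeval g L = 0 := by
  have := congrArg (aeval g) hLMN
  simp only [map_add, map_mul, aeval_X, hg1k, hg2k, hg1b, hg2b, hg1d, hg2d, mul_zero, zero_mul,
    add_zero, map_zero] at this
  exact (mul_eq_zero.1 this).resolve_right (perm22_ne_zero b d hbd)

end Concrete

end Summit.ValiantsHypothesis.LiftNullstellensatz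

end
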